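/-
Origin: written from primary sources — A. Borel, *Automorphic forms on SL₂(ℝ)* (1997) §5.14 (automorphy factors and
their weights at the base point); S. Helgason, *Differential Geometry, Lie Groups, and Symmetric Spaces* (1978)
Ch. VIII §7 (the isotropy representation of a bounded symmetric domain on the holomorphic tangent space);
H. Jacobowitz, *An Introduction to CR Structures* (1990) Ch. 2 §1 (the ball model of `U(2,1)`). Adapted: no.
Elementary: the Jacobian cocycle of `U(2,1)` on the unit ball `𝔹²` (tree `UnitBallJacobian`) restricted to the
isotropy group `K = Stab(x₀)` of the base point is a CHARACTER `k ↦ det D(k)(x₀)`, the determinant of the isotropy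
representation on the holomorphic tangent space `𝔭₊ = T_{x₀}^{1,0} 𝔹²` — i.e. the `K`-type `∧² 𝔭₊`; explicitly
`det k / k₂₂³`. Kernel only.
-/
import Literature.Geometry.ComplexHyperbolic.UnitBallJacobian
import HarnessLib

/-!
# The `∧²𝔭₊` character of the isotropy group of the ball: `k ↦ det D(k)(x₀) = det k / k₂₂³`

Continuation of `UnitBallU21` (the action of `U21 = U(2,1)` on `𝔹²`, base point `x₀ = 0`) and `UnitBallJacobian`
(the Jacobian cocycle `Jac g z`, `Jac (g h) z = Jac g (h z) · Jac h z`, `det (Jac g z) = det g / (g·(z,1))₂³ ≠ 0`).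

* `jacDetUnit g z : ℂˣ` — `det D(g)(z)` as a unit; `jacDetUnit_mul` (the scalar cocycle identity).
* **`isotropyDetChar : MulAction.stabilizer U21 x₀ →* ℂˣ`**, `k ↦ det D(k)(x₀)` — on the isotropy group the
  cocycle is a HOMOMORPHISM (`Jac_mul` + `k' x₀ = x₀`): the determinant of the isotropy representation of `K` on the
  holomorphic tangent space `𝔭₊` at `x₀`, i.e. the `K`-type **`∧² 𝔭₊`** (Helgason VIII §7; Borel §5.14 "weight of the
  canonical automorphy factor");
* `W3_two_of_mem_stabilizer` (`(k·(0,0,1))₂ = k₂₂`), **`coe_isotropyDetChar_eq`**: `det D(k)(x₀) = det k / k₂₂³` —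
  in block form `k = diag(A, d)`, `A ∈ U(2)`, `d ∈ U(1)`: `det A · d⁻²`;
* `continuous_isotropyDetChar` (as a `ℂ`-valued function on `K`).

Provenance / use (Hodge-CM model-construction cell): PerL's index space `𝒮^κ` is the `κ`-isotypic subspace of the
adelic Schwartz–Bruhat space for `κ = ∧²𝔭₊ ⊠ 𝟏` of the maximal compact `K_∞`; this file supplies the factor at the
distinguished place as a character of `Stab(x₀) ≤ U(2,1)`, to be pulled back along the archimedean projection
`archProjU21EmbCM` (`NumberTheory/Automorphic/UnitaryGroupArchProjectionEmb`) and fed to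
`RepresentationTheory/CharacterIsotypicSubspace.weightSpace`. Which power (`κ` or `κ⁻¹`) a consumer wants is the
consumer's convention; both are `MonoidHom`s into the commutative group `ℂˣ`.
-/

noncomputable section

open Matrix Complex MulAction

namespace Literature.Geometry.ComplexHyperbolic

namespace BallModel

/-! ### The Jacobian determinant as a unit-valued cocycle -/

/-- `det D(g)(z)` as a unit of `ℂ` (`det_Jac_ne_zero`). [folklore] -/
def jacDetUnit (g : U21) (z : Ball) : ℂˣ :=
  Units.mk0 (Jac g z).det (det_Jac_ne_zero g z)

/-- Its value. [folklore] -/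
@[simp] theorem coe_jacDetUnit (g : U21) (z : Ball) : (jacDetUnit g z : ℂ) = (Jac g z).det := rfl

/-- The scalar cocycle identity `det D(gh)(z) = det D(g)(h z) · det D(h)(z)`. [folklore] -/
theorem jacDetUnit_mul (g h : U21) (z : Ball) : jacDetUnit (g * h) z = jacDetUnit g (h • z) * jacDetUnit h z :=
  Units.ext (by rw [Units.val_mul, coe_jacDetUnit, coe_jacDetUnit, coe_jacDetUnit, Jac_mul, Matrix.det_mul])

/-- `det D(1)(z) = 1`. [folklore] -/
@[simp] theorem jacDetUnit_one (z : Ball) : jacDetUnit 1 z = 1 :=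
  Units.ext (by rw [coe_jacDetUnit, Jac_one, Matrix.det_one, Units.val_one])

/-! ### The isotropy group and its `∧²𝔭₊` character -/

/-- Elements of the isotropy group fix the base point. [folklore] -/
theorem smul_x₀_of_mem_stabilizer (k : stabilizer U21 x₀) : (k : U21) • x₀ = x₀ :=
  mem_stabilizer_iff.mp k.2

/-- **The `∧²𝔭₊` character of `K = Stab(x₀)`**: `k ↦ det D(k)(x₀)`, the determinant of the isotropy representation
of `K` on the holomorphic tangent space of `𝔹²` at `x₀` — a homomorphism because the Jacobian cocycle restricted to
the stabiliser of `x₀` is multiplicative. (Helgason, DG Lie groups and symmetric spaces, Ch. VIII §7; Borel,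
Automorphic forms on SL₂(ℝ), §5.14) [folklore] -/
def isotropyDetChar : stabilizer U21 x₀ →* ℂˣ where
  toFun k := jacDetUnit (k : U21) x₀
  map_one' := by rw [OneMemClass.coe_one, jacDetUnit_one]
  map_mul' k k' := by rw [Subgroup.coe_mul, jacDetUnit_mul, smul_x₀_of_mem_stabilizer k']

/-- Value of the character: `det D(k)(x₀)`. [folklore] -/
@[simp] theorem coe_isotropyDetChar (k : stabilizer U21 x₀) :
    (isotropyDetChar k : ℂ) = (Jac (k : U21) x₀).det := rfl

/-- For `k` in the isotropy group, `(k · (0,0,1))₂ = k₂₂` (indeed for every `g`, at the base point `x₀ = 0`).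
[folklore] -/
theorem W3_x₀_two (g : U21) : W3 g x₀ 2 = mat g 2 2 := by
  rw [W3_apply, x₀_val, Pi.zero_apply, Pi.zero_apply, mul_zero, mul_zero, zero_add, zero_add]

/-- **Explicit formula**: `det D(k)(x₀) = det k / k₂₂³`; in block form `k = diag(A, d)` (`A ∈ U(2)`, `d ∈ U(1)`,
forced by `k · 0 = 0` and unitarity) this is `det A · d⁻²`, the character of `U(2) × U(1)` on `∧²(ℂ² ⊗ d⁻¹)`.
[folklore] -/
theorem coe_isotropyDetChar_eq (k : stabilizer U21 x₀) :
    (isotropyDetChar k : ℂ) = (mat (k : U21)).det / mat (k : U21) 2 2 ^ 3 := by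
  rw [coe_isotropyDetChar, det_Jac, W3_x₀_two]

/-- `k₂₂ ≠ 0` on the isotropy group (indeed for every `g ∈ U(2,1)`). [folklore] -/
theorem mat_two_two_ne_zero (g : U21) : mat g 2 2 ≠ 0 := by
  rw [← W3_x₀_two]; exact W3_2_ne_zero g x₀

/-- Continuity of the character as a `ℂ`-valued function on `K`. [folklore] -/
theorem continuous_isotropyDetChar : Continuous fun k : stabilizer U21 x₀ => (isotropyDetChar k : ℂ) := by
  simp only [coe_isotropyDetChar]
  exact (Continuous.matrix_det (continuous_Jac x₀)).comp continuous_subtype_val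

/-- The inverse character `k ↦ det D(k)(x₀)⁻¹` (the `K`-type `∧²𝔭₊^*`, weight of holomorphic `2`-forms), for
consumers with the dual convention. [folklore] -/
def isotropyDetCharInv : stabilizer U21 x₀ →* ℂˣ := (isotropyDetChar)⁻¹

/-- Value of the inverse character. [folklore] -/
theorem coe_isotropyDetCharInv (k : stabilizer U21 x₀) :
    (isotropyDetCharInv k : ℂ) = ((Jac (k : U21) x₀).det)⁻¹ := by
  rw [isotropyDetCharInv, MonoidHom.inv_apply, Units.val_inv_eq_inv_val, coe_isotropyDetChar]

end BallModel

end Literature.Geometry.ComplexHyperbolic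

end
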